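import Mathlib
import HarnessLib
import Summits.AtomisticToContinuum.Crystallization.Theorems.HolmgrenBoyleLindHalfSpaceUniqueContinuationThickColumnHorizontal
import Summits.AtomisticToContinuum.Crystallization.Theorems.HolmgrenBoyleLindHalfSpaceUniqueContinuationInterfaceSources
import Summits.AtomisticToContinuum.Crystallization.Theorems.HolmgrenBoyleLindHalfSpaceUniqueContinuationTransverseBlaschke
import Summits.AtomisticToContinuum.Crystallization.Theorems.HolmgrenBoyleLindHalfSpaceUniqueContinuationRungsOfCores
import Summits.AtomisticToContinuum.Crystallization.Theorems.HolmgrenBoyleLindUCContinuum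
import Summits.AtomisticToContinuum.Crystallization.Theorems.HolmgrenBoyleLindCentrosymmetric

/-!
# Route `HolmgrenBoyleLind`: Lennard-Jones force fields of separated sources, part 20c —
THICK-COLUMN RIGIDITY (pair form): one thick column and a generic layer lattice

Support file for the crux item stmt-AtomisticToContinuum-6075 (`HalfSpaceUniqueContinuation`, line
`registered`, layered core; written by lead c3). A THICK column (a normal column below the plane
carrying a non-Blaschke set of points of `ω`) is a zero column of the signed difference field
(transverse Blaschke, `hbl_inner_field_eq_zero_on_normal_ray`); parts 20a/20b turn it into three
equations per shell and height fibre, which a GENERIC layer lattice (every shell of the dual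
lattice is `{w, −w}`) resolves.

* `hbl_ne_neg_of_ne_zero`;
* **`hbl_fibres_eq_zero_of_column_generic`** — a clean column of a generic layer lattice empties
  every height fibre of every signed structure factor;
* **`hbl_thickColumn_rigidity'`** (+ registered `∀`-form `hbl_thickColumn_rigidity`) — two
  `δ`-separated sets in exact Lennard-Jones force balance with common horizontal periods `s, t`
  spanning a generic lattice, agreeing below a horizontal plane, one of which has ONE thick normal
  column below the plane, coincide. This closes the thick-CLASS world of the layered core for
  generic layer lattices with a single column (compare `hbl_eq_of_recurrent_columns`, which needs a
  recurrent column below every point, and `hbl_interface_rigidity'`, which needs none).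
All `[folklore]`; nothing here closes an item.
-/

noncomputable section

namespace Summit.AtomisticToContinuum.Crystallization.Theorems.HolmgrenBoyleLind

open scoped BigOperators Topology InnerProductSpace RealInnerProductSpace FourierTransform
open MeasureTheory Filter Set Literature.Algebra.EuclideanLattices.LatticePeriodic
  Literature.Analysis.SpecialFunctions
open scoped Classical

/-! ## Resolution of the shell equations for a generic layer lattice -/

section Generic

variable {u : EuclideanSpace ℝ (Fin 3)} (hu : ‖u‖ = 1) (Λ : Submodule ℤ (ℝ ∙ u)ᗮ)
  [DiscreteTopology Λ] [IsZLattice ℝ Λ] {Dp Dm : Set (EuclideanSpace ℝ (Fin 3))} {δ a : ℝ}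
  (hδ : 0 < δ)
  (hsepp : ∀ x ∈ Dp, ∀ y ∈ Dp, x ≠ y → δ ≤ dist x y)
  (hsepm : ∀ x ∈ Dm, ∀ y ∈ Dm, x ≠ y → δ ≤ dist x y)
  (hap : ∀ y ∈ Dp, a ≤ ⟪y, u⟫) (ham : ∀ y ∈ Dm, a ≤ ⟪y, u⟫)
  (hDp : ∀ ℓ : Λ, ∀ y : EuclideanSpace ℝ (Fin 3),
    y + ((ℓ : (ℝ ∙ u)ᗮ) : EuclideanSpace ℝ (Fin 3)) ∈ Dp ↔ y ∈ Dp)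
  (hDm : ∀ ℓ : Λ, ∀ y : EuclideanSpace ℝ (Fin 3),
    y + ((ℓ : (ℝ ∙ u)ᗮ) : EuclideanSpace ℝ (Fin 3)) ∈ Dm ↔ y ∈ Dm)

/-- A non-zero integer frequency is not its own negative. [folklore] -/
theorem hbl_ne_neg_of_ne_zero {n : ℕ} {k : Fin n → ℤ} (hk : k ≠ 0) : k ≠ -k := by
  intro h
  apply hk
  funext i
  have hi := congrFun h i
  simp only [Pi.neg_apply] at hi
  simp only [Pi.zero_apply]
  omega

include hu hδ hsepp hsepm hap ham hDp hDm in
/-- **A clean column empties every fibre when the layer lattice is generic.** Suppose the dual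
lattice of `Λ` is GENERIC: two dual vectors of equal length are equal or opposite (every shell is
`{k, −k}`; true for all rank-2 lattices except the rectangular, centred-rectangular/rhombic, square
and hexagonal families). If all three components of the signed field vanish along the column
`b₀ + (a − X) u`, `X > X₁ > 0`, then every height fibre of every signed structure factor vanishes:
for `k = 0` this is (i) of `hbl_vshells_eq_zero_of_column'`; for `k ≠ 0` the vertical shell
equation `e_k(b₀) F_k + e_{−k}(b₀) F_{−k} = 0` and the horizontal one with `c = w_k`,
`‖w_k‖² (e_k(b₀) F_k − e_{−k}(b₀) F_{−k}) = 0`, give `F_k = 0`. [folklore] -/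
theorem hbl_fibres_eq_zero_of_column_generic
    (hgen : ∀ k k' : Fin (Module.finrank ℝ (ℝ ∙ u)ᗮ) → ℤ,
      ‖dualVec Λ k'‖ = ‖dualVec Λ k‖ → k' = k ∨ k' = -k)
    (b₀ : (ℝ ∙ u)ᗮ) {X₁ : ℝ} (hX₁ : 0 < X₁)
    (hcol : ∀ (e : EuclideanSpace ℝ (Fin 3)) (X : ℝ), X₁ < X →
      (∑' yy : ↥(Dp ∪ Dm), (if (yy : EuclideanSpace ℝ (Fin 3)) ∈ Dp then (1 : ℂ) else -1) *
        ((⟪e, ((((‖((b₀ : EuclideanSpace ℝ (Fin 3)) + (a - X) • u) - (yy : EuclideanSpace ℝ (Fin 3))‖ ^ 2) ^ 4)⁻¹ -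
            ((‖((b₀ : EuclideanSpace ℝ (Fin 3)) + (a - X) • u) - (yy : EuclideanSpace ℝ (Fin 3))‖ ^ 2) ^ 7)⁻¹) •
              (((b₀ : EuclideanSpace ℝ (Fin 3)) + (a - X) • u) - (yy : EuclideanSpace ℝ (Fin 3))))⟫ : ℝ) : ℂ)) = 0) :
    ∀ (k : Fin (Module.finrank ℝ (ℝ ∙ u)ᗮ) → ℤ) (η : ℝ)
      (T : Finset {q : EuclideanSpace ℝ (Fin 3) //
        q ∈ Dp ∪ Dm ∧ (ℝ ∙ u)ᗮ.orthogonalProjectionOnto q ∈ fdom Λ}),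
      (∀ q, q ∈ T ↔ ⟪(q : EuclideanSpace ℝ (Fin 3)), u⟫ = η) →
      ∑ q ∈ T, (if ((q : EuclideanSpace ℝ (Fin 3)) ∈ Dp) then (1 : ℂ) else -1) *
        echar Λ (-k) ((ℝ ∙ u)ᗮ.orthogonalProjectionOnto (q : EuclideanSpace ℝ (Fin 3))) = 0 := by
  classical
  intro k η T hT
  obtain ⟨hzero, hvert⟩ := hbl_vshells_eq_zero_of_column' hu Λ hδ hsepp hsepm hap ham hDp hDm b₀ hX₁
    (hcol u)
  by_cases hk : k = 0
  · -- the zero mode: signed counts of the fibres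
    have h0 := hzero η T hT
    rw [hk, neg_zero]
    simpa only [echar_zero, mul_one] using h0
  · -- the shell `{k, -k}`
    have hw : dualVec Λ k ≠ 0 := by
      intro h0
      apply hk
      exact dualVec_injective Λ (h0.trans (hbl_dualVec_zero Λ).symm)
    have hknk : k ≠ -k := hbl_ne_neg_of_ne_zero hk
    have hshell : Finset.filter (fun k' => ‖dualVec Λ k'‖ = ‖dualVec Λ k‖)
        (finite_norm_dualVec_le Λ ‖dualVec Λ k‖).toFinset = {k, -k} := by
      ext k'
      rw [Finset.mem_filter, Set.Finite.mem_toFinset, Set.mem_setOf_eq, Finset.mem_insert,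
        Finset.mem_singleton]
      constructor
      · intro h
        exact hgen k k' h.2
      · rintro (h | h)
        · rw [h]; exact ⟨le_rfl, rfl⟩
        · rw [h, dualVec_neg, norm_neg]; exact ⟨le_rfl, rfl⟩
    -- abbreviate the fibre sums
    set F : (Fin (Module.finrank ℝ (ℝ ∙ u)ᗮ) → ℤ) → ℂ := fun k' =>
      ∑ q ∈ T, (if ((q : EuclideanSpace ℝ (Fin 3)) ∈ Dp) then (1 : ℂ) else -1) *
        echar Λ (-k') ((ℝ ∙ u)ᗮ.orthogonalProjectionOnto (q : EuclideanSpace ℝ (Fin 3))) with hF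
    have hV := hvert k hk η T hT
    have hH := hbl_hshells_eq_zero_of_column' hu Λ hδ hsepp hsepm hap ham hDp hDm b₀ (dualVec Λ k) hw
      hX₁ (hcol _) k hk η T hT
    rw [hshell, Finset.sum_pair hknk] at hV hH
    rw [dualVec_neg, inner_neg_right, real_inner_self_eq_norm_sq] at hH
    change echar Λ k b₀ * F k + echar Λ (-k) b₀ * F (-k) = 0 at hV
    change echar Λ k b₀ * ((‖dualVec Λ k‖ ^ 2 : ℝ) : ℂ) * F k +
      echar Λ (-k) b₀ * ((-(‖dualVec Λ k‖ ^ 2) : ℝ) : ℂ) * F (-k) = 0 at hH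
    change F k = 0
    have hρ2 : ((‖dualVec Λ k‖ ^ 2 : ℝ) : ℂ) ≠ 0 := by
      have : (0 : ℝ) < ‖dualVec Λ k‖ ^ 2 := by have := norm_pos_iff.2 hw; positivity
      exact_mod_cast this.ne'
    have hek : echar Λ k b₀ ≠ 0 := by
      rw [← norm_pos_iff, norm_echar]; exact one_pos
    -- `ρ² · hV + hH = 2 e_k(b₀) ρ² F_k`
    have hsum : (2 : ℂ) * (echar Λ k b₀ * ((‖dualVec Λ k‖ ^ 2 : ℝ) : ℂ) * F k) = 0 := by
      have := congrArg (fun z : ℂ => ((‖dualVec Λ k‖ ^ 2 : ℝ) : ℂ) * z) hV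
      simp only [mul_zero] at this
      push_cast at hH this ⊢
      linear_combination this + hH
    rcases mul_eq_zero.1 hsum with h2 | h2
    · norm_num at h2
    · rcases mul_eq_zero.1 h2 with h3 | h3
      · rcases mul_eq_zero.1 h3 with h4 | h4
        · exact (hek h4).elim
        · exact (hρ2 h4).elim
      · exact h3

end Generic


/-! ## Thick-column rigidity (pair form) -/

/-- **THICK-COLUMN RIGIDITY (pair form).** Let `ω, ω' ⊂ ℝ³` be `δ`-separated and in exact
Lennard-Jones force balance, with two common independent horizontal periods `s, t ⊥ u`
(`‖u‖ = 1`), agreeing on the open half-space `{⟪z, u⟫ < a}`, and suppose the layer lattice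
`ℤs + ℤt` is GENERIC: two horizontal vectors pairing integrally with `s` and `t` and of equal
length are equal or opposite. If ONE normal column below the plane is thick in `ω` — it carries
points `x₀ − tₙ u ∈ ω`, `⟪x₀, u⟫ < a`, `tₙ ≥ 1` injective with `∑ 1/tₙ = ∞` (e.g. bounded gaps) —
then `ω = ω'`. Proof: the difference field vanishes at the column points (force balance of both
sets), hence on the whole open column (transverse Blaschke, `hbl_inner_field_eq_zero_on_normal_ray`);
by `hbl_fibres_eq_zero_of_column_generic` every height fibre of every signed structure factor of
the defect sets vanishes, and `hbl_signedSource_empty_of_fibres` empties them. Compare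
`hbl_eq_of_recurrent_columns` (a recurrent column below EVERY point, no periodicity) and
`hbl_interface_rigidity'` (no thick column at all, irrational registry). [folklore] -/
theorem hbl_thickColumn_rigidity' {ω ω' : Set (EuclideanSpace ℝ (Fin 3))} {δ : ℝ} (hδ : 0 < δ)
    (hsep : ∀ x ∈ ω, ∀ y ∈ ω, x ≠ y → δ ≤ dist x y)
    (hsep' : ∀ x ∈ ω', ∀ y ∈ ω', x ≠ y → δ ≤ dist x y)
    (hbal : ∀ x ∈ ω, HasSum (fun y : {y : EuclideanSpace ℝ (Fin 3) // y ∈ ω ∧ y ≠ x} =>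
      (deriv Literature.MathematicalPhysics.StatisticalMechanics.lennardJones (dist x y) / dist x y) •
        (x - (y : EuclideanSpace ℝ (Fin 3)))) 0)
    (hbal' : ∀ x ∈ ω', HasSum (fun y : {y : EuclideanSpace ℝ (Fin 3) // y ∈ ω' ∧ y ≠ x} =>
      (deriv Literature.MathematicalPhysics.StatisticalMechanics.lennardJones (dist x y) / dist x y) •
        (x - (y : EuclideanSpace ℝ (Fin 3)))) 0)
    {s t u : EuclideanSpace ℝ (Fin 3)} {a : ℝ} (hu : ‖u‖ = 1) (ht0 : t ≠ 0)
    (hst : s ∉ Submodule.span ℝ ({t} : Set (EuclideanSpace ℝ (Fin 3))))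
    (hsu : ⟪s, u⟫ = 0) (htu : ⟪t, u⟫ = 0)
    (hωt : ∀ x : EuclideanSpace ℝ (Fin 3), x + t ∈ ω ↔ x ∈ ω)
    (hωs : ∀ x : EuclideanSpace ℝ (Fin 3), x + s ∈ ω ↔ x ∈ ω)
    (hω't : ∀ x : EuclideanSpace ℝ (Fin 3), x + t ∈ ω' ↔ x ∈ ω')
    (hω's : ∀ x : EuclideanSpace ℝ (Fin 3), x + s ∈ ω' ↔ x ∈ ω')
    (hagree : ∀ z : EuclideanSpace ℝ (Fin 3), ⟪z, u⟫ < a → (z ∈ ω ↔ z ∈ ω'))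
    (hgen : ∀ w w' : EuclideanSpace ℝ (Fin 3), ⟪w, u⟫ = 0 → ⟪w', u⟫ = 0 →
      (∃ m : ℤ, ⟪w, s⟫ = m) → (∃ m : ℤ, ⟪w, t⟫ = m) →
      (∃ m : ℤ, ⟪w', s⟫ = m) → (∃ m : ℤ, ⟪w', t⟫ = m) → ‖w'‖ = ‖w‖ → w' = w ∨ w' = -w)
    {x₀ : EuclideanSpace ℝ (Fin 3)} (hx₀a : ⟪x₀, u⟫ < a) {tn : ℕ → ℝ} (htn : ∀ n, 1 ≤ tn n)
    (hinj : Function.Injective tn) (hns : ¬ Summable (fun n => (tn n)⁻¹))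
    (hcolω : ∀ n, x₀ - tn n • u ∈ ω) :
    ω = ω' := by
  classical
  -- the plane and its lattice of common periods
  have hu0 : u ≠ 0 := by
    intro h0; rw [h0, norm_zero] at hu; exact zero_ne_one hu
  have hV : Module.finrank ℝ (ℝ ∙ u)ᗮ = 2 := hbl_finrank_orthogonal_span_singleton hu0
  have hsW : s ∈ (ℝ ∙ u)ᗮ := by
    rw [Submodule.mem_orthogonal_singleton_iff_inner_right, real_inner_comm]; exact hsu
  have htW : t ∈ (ℝ ∙ u)ᗮ := by
    rw [Submodule.mem_orthogonal_singleton_iff_inner_right, real_inner_comm]; exact htu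
  set sW : (ℝ ∙ u)ᗮ := ⟨s, hsW⟩ with hsWdef
  set tW : (ℝ ∙ u)ᗮ := ⟨t, htW⟩ with htWdef
  have hli : LinearIndependent ℝ ![tW, sW] := by
    rw [LinearIndependent.pair_iff]
    intro c d hcd
    have hcd' : c • t + d • s = 0 := by
      have := congrArg (fun x : (ℝ ∙ u)ᗮ => (x : EuclideanSpace ℝ (Fin 3))) hcd
      simpa [hsWdef, htWdef] using this
    by_cases hd : d = 0
    · refine ⟨?_, hd⟩
      rw [hd, zero_smul, add_zero] at hcd'
      exact (smul_eq_zero.1 hcd').resolve_right ht0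
    · exfalso
      apply hst
      have hs_eq : s = (-(c / d)) • t := by
        have : d • s = -(c • t) := eq_neg_of_add_eq_zero_right hcd'
        calc s = d⁻¹ • (d • s) := by rw [smul_smul, inv_mul_cancel₀ hd, one_smul]
          _ = (-(c / d)) • t := by rw [this, smul_neg, smul_smul, neg_smul]; ring_nf
      rw [hs_eq]
      exact Submodule.smul_mem _ _ (Submodule.mem_span_singleton_self t)
  set bW : Module.Basis (Fin 2) ℝ (ℝ ∙ u)ᗮ :=
    basisOfLinearIndependentOfCardEqFinrank hli (by rw [hV]; simp) with hbW
  set Λ : Submodule ℤ (ℝ ∙ u)ᗮ := Submodule.span ℤ (Set.range bW) with hΛ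
  have hbW0 : bW 0 = tW := by rw [hbW, coe_basisOfLinearIndependentOfCardEqFinrank]; rfl
  have hbW1 : bW 1 = sW := by rw [hbW, coe_basisOfLinearIndependentOfCardEqFinrank]; rfl
  have htΛ : tW ∈ Λ := hbW0 ▸ Submodule.subset_span ⟨0, rfl⟩
  have hsΛ : sW ∈ Λ := hbW1 ▸ Submodule.subset_span ⟨1, rfl⟩
  -- invariance of `ω, ω'` under `Λ`
  have hinvgen : ∀ (S : Set (EuclideanSpace ℝ (Fin 3))),
      (∀ x : EuclideanSpace ℝ (Fin 3), x + t ∈ S ↔ x ∈ S) →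
      (∀ x : EuclideanSpace ℝ (Fin 3), x + s ∈ S ↔ x ∈ S) →
      ∀ ℓ : Λ, ∀ y : EuclideanSpace ℝ (Fin 3),
        y + ((ℓ : (ℝ ∙ u)ᗮ) : EuclideanSpace ℝ (Fin 3)) ∈ S ↔ y ∈ S := by
    intro S hSt hSs ℓ
    refine hbl_invariant_of_span bW (S := S) (fun i => ?_) ℓ.2
    fin_cases i
    · simpa [hbW0, htWdef] using hSt
    · simpa [hbW1, hsWdef] using hSs
  have hωΛ := hinvgen ω hωt hωs
  have hω'Λ := hinvgen ω' hω't hω's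
  -- the signed source `Dp = ω ∖ ω'`, `Dm = ω' ∖ ω`
  set Dp : Set (EuclideanSpace ℝ (Fin 3)) := {y | y ∈ ω ∧ y ∉ ω'} with hDpdef
  set Dm : Set (EuclideanSpace ℝ (Fin 3)) := {y | y ∈ ω' ∧ y ∉ ω} with hDmdef
  have hdisj : Disjoint Dp Dm := Set.disjoint_left.2 fun y hp hm => hm.2 hp.1
  have hsepp : ∀ x ∈ Dp, ∀ y ∈ Dp, x ≠ y → δ ≤ dist x y :=
    fun x hx y hy hxy => hsep x hx.1 y hy.1 hxy
  have hsepm : ∀ x ∈ Dm, ∀ y ∈ Dm, x ≠ y → δ ≤ dist x y :=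
    fun x hx y hy hxy => hsep' x hx.1 y hy.1 hxy
  have hap : ∀ y ∈ Dp, a ≤ ⟪y, u⟫ := by
    intro y hy
    by_contra hlt
    exact hy.2 ((hagree y (not_le.1 hlt)).1 hy.1)
  have ham : ∀ y ∈ Dm, a ≤ ⟪y, u⟫ := by
    intro y hy
    by_contra hlt
    exact hy.2 ((hagree y (not_le.1 hlt)).2 hy.1)
  have hDp : ∀ ℓ : Λ, ∀ y : EuclideanSpace ℝ (Fin 3),
      y + ((ℓ : (ℝ ∙ u)ᗮ) : EuclideanSpace ℝ (Fin 3)) ∈ Dp ↔ y ∈ Dp := by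
    intro ℓ y
    simp only [hDpdef, Set.mem_setOf_eq]
    rw [hωΛ ℓ y, hω'Λ ℓ y]
  have hDm : ∀ ℓ : Λ, ∀ y : EuclideanSpace ℝ (Fin 3),
      y + ((ℓ : (ℝ ∙ u)ᗮ) : EuclideanSpace ℝ (Fin 3)) ∈ Dm ↔ y ∈ Dm := by
    intro ℓ y
    simp only [hDmdef, Set.mem_setOf_eq]
    rw [hωΛ ℓ y, hω'Λ ℓ y]
  -- genericity of the dual lattice
  have hgenΛ : ∀ k k' : Fin (Module.finrank ℝ (ℝ ∙ u)ᗮ) → ℤ,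
      ‖dualVec Λ k'‖ = ‖dualVec Λ k‖ → k' = k ∨ k' = -k := by
    intro k k' hkk'
    have hor : ∀ kk : Fin (Module.finrank ℝ (ℝ ∙ u)ᗮ) → ℤ,
        ⟪((dualVec Λ kk : (ℝ ∙ u)ᗮ) : EuclideanSpace ℝ (Fin 3)), u⟫ = 0 :=
      fun kk => hbl_inner_coe_orthogonal u _
    have hins : ∀ kk : Fin (Module.finrank ℝ (ℝ ∙ u)ᗮ) → ℤ,
        ∃ m : ℤ, ⟪((dualVec Λ kk : (ℝ ∙ u)ᗮ) : EuclideanSpace ℝ (Fin 3)), s⟫ = m := by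
      intro kk
      obtain ⟨m, hm⟩ := inner_dualVec_of_mem Λ kk hsΛ
      exact ⟨m, by rw [show s = ((sW : (ℝ ∙ u)ᗮ) : EuclideanSpace ℝ (Fin 3)) from rfl,
        ← Submodule.coe_inner]; exact hm⟩
    have hint : ∀ kk : Fin (Module.finrank ℝ (ℝ ∙ u)ᗮ) → ℤ,
        ∃ m : ℤ, ⟪((dualVec Λ kk : (ℝ ∙ u)ᗮ) : EuclideanSpace ℝ (Fin 3)), t⟫ = m := by
      intro kk
      obtain ⟨m, hm⟩ := inner_dualVec_of_mem Λ kk htΛ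
      exact ⟨m, by rw [show t = ((tW : (ℝ ∙ u)ᗮ) : EuclideanSpace ℝ (Fin 3)) from rfl,
        ← Submodule.coe_inner]; exact hm⟩
    have hnorm : ‖((dualVec Λ k' : (ℝ ∙ u)ᗮ) : EuclideanSpace ℝ (Fin 3))‖ =
        ‖((dualVec Λ k : (ℝ ∙ u)ᗮ) : EuclideanSpace ℝ (Fin 3))‖ := by
      exact_mod_cast hkk'
    rcases hgen _ _ (hor k) (hor k') (hins k) (hint k) (hins k') (hint k') hnorm with h | h
    · left
      exact dualVec_injective Λ (SetLike.coe_eq_coe.1 h)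
    · right
      apply dualVec_injective Λ
      rw [dualVec_neg]
      exact_mod_cast h
  -- the column: base registry `b₀ = P x₀`, first depth `X₁ = a − ⟪x₀, u⟫`
  set b₀ : (ℝ ∙ u)ᗮ := (ℝ ∙ u)ᗮ.orthogonalProjectionOnto x₀ with hb₀
  have hX₁ : 0 < a - ⟪x₀, u⟫ := by linarith
  have hx₀eq : x₀ = (b₀ : EuclideanSpace ℝ (Fin 3)) + ⟪x₀, u⟫ • u := hbl_eq_proj_add_inner_smul hu x₀
  -- all components of the signed field vanish on the open column below `x₀`
  have hcol : ∀ (e : EuclideanSpace ℝ (Fin 3)) (X : ℝ), a - ⟪x₀, u⟫ < X →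
      (∑' yy : ↥(Dp ∪ Dm), (if (yy : EuclideanSpace ℝ (Fin 3)) ∈ Dp then (1 : ℂ) else -1) *
        ((⟪e, ((((‖((b₀ : EuclideanSpace ℝ (Fin 3)) + (a - X) • u) - (yy : EuclideanSpace ℝ (Fin 3))‖ ^ 2) ^ 4)⁻¹ -
            ((‖((b₀ : EuclideanSpace ℝ (Fin 3)) + (a - X) • u) - (yy : EuclideanSpace ℝ (Fin 3))‖ ^ 2) ^ 7)⁻¹) •
              (((b₀ : EuclideanSpace ℝ (Fin 3)) + (a - X) • u) - (yy : EuclideanSpace ℝ (Fin 3))))⟫ : ℝ) : ℂ)) = 0 := by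
    intro e X hX
    have hX0 : 0 < X := hX₁.trans hX
    -- the ray `p + σ v`, `p = x₀`, `v = -u`
    have hvn : ‖-u‖ = 1 := by rw [norm_neg, hu]
    have hclp : ∀ y ∈ Dp, a - ⟪x₀, u⟫ ≤ ⟪x₀ - y, -u⟫ := by
      intro y hy
      rw [inner_neg_right, inner_sub_left]
      linarith [hap y hy]
    have hclm : ∀ y ∈ Dm, a - ⟪x₀, u⟫ ≤ ⟪x₀ - y, -u⟫ := by
      intro y hy
      rw [inner_neg_right, inner_sub_left]
      linarith [ham y hy]
    have hpt : ∀ σ : ℝ, x₀ + σ • (-u) = x₀ - σ • u := fun σ => by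
      rw [smul_neg, sub_eq_add_neg]
    have hΦ0 : ∀ n : ℕ,
        (∑' y : Dp, (deriv Literature.MathematicalPhysics.StatisticalMechanics.lennardJones
            (dist (x₀ + tn n • (-u)) y) / dist (x₀ + tn n • (-u)) y) •
            (x₀ + tn n • (-u) - (y : EuclideanSpace ℝ (Fin 3)))) -
          (∑' y : Dm, (deriv Literature.MathematicalPhysics.StatisticalMechanics.lennardJones
            (dist (x₀ + tn n • (-u)) y) / dist (x₀ + tn n • (-u)) y) •
            (x₀ + tn n • (-u) - (y : EuclideanSpace ℝ (Fin 3)))) = 0 := by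
      intro n
      rw [hpt]
      have hin : ⟪x₀ - tn n • u, u⟫ < a := by
        rw [inner_sub_left, real_inner_smul_left, real_inner_self_eq_norm_sq, hu]
        linarith [htn n]
      exact hbl_diffField_eq_zero_on_halfSpace hδ hsep hsep' hbal hbal' hagree _ (hcolω n) hin
    have hray := hbl_inner_field_eq_zero_on_normal_ray Dp Dm δ (a - ⟪x₀, u⟫) hδ hX₁ hsepp hsepm x₀
      (-u) e hvn hclp hclm tn htn hinj hns (fun n => by rw [hΦ0 n, inner_zero_right])
      (X - (a - ⟪x₀, u⟫)) (by linarith)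
    -- the point `x₀ + (X - X₁)(-u)` is `b₀ + (a - X) u`
    have hz : x₀ + (X - (a - ⟪x₀, u⟫)) • (-u) = (b₀ : EuclideanSpace ℝ (Fin 3)) + (a - X) • u := by
      have e1 : (a - X) • u = ⟪x₀, u⟫ • u - (X - (a - ⟪x₀, u⟫)) • u := by
        rw [← sub_smul]; congr 1; ring
      rw [e1, smul_neg, ← sub_eq_add_neg, ← add_sub_assoc, ← hx₀eq]
    rw [hz] at hray
    set z : EuclideanSpace ℝ (Fin 3) := (b₀ : EuclideanSpace ℝ (Fin 3)) + (a - X) • u with hzdef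
    -- rewrite the pair forces as kernels
    have hzu : ⟪z, u⟫ = a - X := by
      rw [hzdef, inner_add_left, hbl_inner_coe_orthogonal u b₀, real_inner_smul_left,
        real_inner_self_eq_norm_sq, hu]
      ring
    have hker : ∀ y : EuclideanSpace ℝ (Fin 3), y ∈ Dp ∪ Dm →
        (deriv Literature.MathematicalPhysics.StatisticalMechanics.lennardJones (dist z y) / dist z y) •
          (z - y) = ((((‖z - y‖ ^ 2) ^ 4)⁻¹ - ((‖z - y‖ ^ 2) ^ 7)⁻¹) • (z - y)) := by
      intro y hy
      refine ljForce_eq_kernel fun hyz => ?_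
      have hay : a ≤ ⟪y, u⟫ := by
        rcases hy with h | h
        · exact hap y h
        · exact ham y h
      rw [hyz, hzu] at hay
      linarith
    have hvec' : ⟪e, (∑' y : Dp, ((((‖z - (y : EuclideanSpace ℝ (Fin 3))‖ ^ 2) ^ 4)⁻¹ -
          ((‖z - (y : EuclideanSpace ℝ (Fin 3))‖ ^ 2) ^ 7)⁻¹) • (z - (y : EuclideanSpace ℝ (Fin 3))))) -
        (∑' y : Dm, ((((‖z - (y : EuclideanSpace ℝ (Fin 3))‖ ^ 2) ^ 4)⁻¹ -
          ((‖z - (y : EuclideanSpace ℝ (Fin 3))‖ ^ 2) ^ 7)⁻¹) • (z - (y : EuclideanSpace ℝ (Fin 3)))))⟫ = 0 := by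
      rw [← hray]
      congr 2
      · exact tsum_congr fun y => (hker y (Or.inl y.2)).symm
      · exact tsum_congr fun y => (hker y (Or.inr y.2)).symm
    have hid := hbl_inner_signedField_eq_tsum hu hδ hdisj hsepp hsepm hap ham e b₀ hX0 z hzdef
    rw [hvec', Complex.ofReal_zero] at hid
    convert hid.symm using 4
    split_ifs <;> rfl
  have key := hbl_fibres_eq_zero_of_column_generic hu Λ hδ hsepp hsepm hap ham hDp hDm hgenΛ b₀ hX₁
    (fun e X hX => by convert hcol e X hX using 4; split_ifs <;> rfl)
  obtain ⟨hDp0, hDm0⟩ := hbl_signedSource_empty_of_fibres hu Λ hδ hdisj hsepp hsepm hap ham hDp hDm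
    key
  ext y
  constructor
  · intro hy
    by_contra hy'
    have : y ∈ Dp := ⟨hy, hy'⟩
    rw [hDp0] at this
    exact this
  · intro hy'
    by_contra hy
    have : y ∈ Dm := ⟨hy', hy⟩
    rw [hDm0] at this
    exact this

/-- **THICK-COLUMN RIGIDITY** (registered `∀`-form of `hbl_thickColumn_rigidity'`). [folklore] -/
theorem hbl_thickColumn_rigidity : ∀ (ω ω' : Set (EuclideanSpace ℝ (Fin 3))) (δ : ℝ), 0 < δ → (∀ x ∈ ω, ∀ y ∈ ω, x ≠ y → δ ≤ dist x y) → (∀ x ∈ ω', ∀ y ∈ ω', x ≠ y → δ ≤ dist x y) → (∀ x ∈ ω, HasSum (fun y : {y : EuclideanSpace ℝ (Fin 3) // y ∈ ω ∧ y ≠ x} => (deriv Literature.MathematicalPhysics.StatisticalMechanics.lennardJones (dist x y) / dist x y) • (x - (y : EuclideanSpace ℝ (Fin 3)))) 0) → (∀ x ∈ ω', HasSum (fun y : {y : EuclideanSpace ℝ (Fin 3) // y ∈ ω' ∧ y ≠ x} => (deriv Literature.MathematicalPhysics.StatisticalMechanics.lennardJones (dist x y) / dist x y) • (x - (y : EuclideanSpace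 ℝ (Fin 3)))) 0) → ∀ (s t u : EuclideanSpace ℝ (Fin 3)) (a : ℝ), ‖u‖ = 1 → t ≠ 0 → s ∉ Submodule.span ℝ ({t} : Set (EuclideanSpace ℝ (Fin 3))) → inner ℝ s u = 0 → inner ℝ t u = 0 → (∀ x : EuclideanSpace ℝ (Fin 3), x + t ∈ ω ↔ x ∈ ω) → (∀ x : EuclideanSpace ℝ (Fin 3), x + s ∈ ω ↔ x ∈ ω) → (∀ x : EuclideanSpace ℝ (Fin 3), x + t ∈ ω' ↔ x ∈ ω') → (∀ x : EuclideanSpace ℝ (Fin 3), x + s ∈ ω' ↔ x ∈ ω') → (∀ z : EuclideanSpace ℝ (Fin 3), inner ℝ z u < a → (z ∈ ω ↔ z ∈ ω')) → (∀ w w' : EuclideanSpace ℝ (Fin 3), inner ℝ w u = 0 → inner ℝ w' u = 0 → (∃ m : ℤ, inner ℝ w s = m) → (∃ m : ℤ, inner ℝ w t = m) → (∃ m : ℤ, inner ℝ w' s = m) → (∃ m : ℤ, inner ℝ w' t = m) → ‖w'‖ = ‖w‖ → w' = w ∨ w' = -w) → ∀ (x₀ : EuclideanSpace ℝ (Fin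 3)) (tn : ℕ → ℝ), inner ℝ x₀ u < a → (∀ n : ℕ, 1 ≤ tn n) → Function.Injective tn → ¬ Summable (fun n : ℕ => (tn n)⁻¹) → (∀ n : ℕ, x₀ - tn n • u ∈ ω) → ω = ω' := by
  intro ω ω' δ hδ hsep hsep' hbal hbal' s t u a hu ht0 hst hsu htu hωt hωs hω't hω's hagree hgen x₀ tn
    hx₀a htn hinj hns hcolω
  exact hbl_thickColumn_rigidity' hδ hsep hsep' hbal hbal' hu ht0 hst hsu htu hωt hωs hω't hω's hagree
    hgen hx₀a htn hinj hns hcolω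

end Summit.AtomisticToContinuum.Crystallization.Theorems.HolmgrenBoyleLind

end
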